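/-
Origin: expansion seat `prover-pub-hodgecm-mc-binder-2-g14-0`, handover #R5 2026-08-20T11:00Z md5 3292f444f5ac (PKG 9f9ae8e3a675 → 3292f444f5ac; 433 l.; `KindVar` 4th minor; arms `kindIncl/_injective`; `HypIdx.eq_sigma` REPLACED BY `HypIdx.eq_sigma_or_eq_sigmaSwap` (old statement false; 0 users); `kindIncl_hypLoc_sigmaSwap`; ctors `PlaceDatum.sigmaPosSwap/sigmaNegSwap` + `_kind`) (`HOME/mc/pub-hodgecm-mc-binder-2/g14/t12/HodgeCM/Model/HypCensus/PlaceDatum.lean`, md5 3292f444f5ac, 433 lines);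
landed by the second packager p2 gen 7 (p2-g7) in gate run 50 REPLACES the earlier landed copy of `HodgeCM/Model/HypCensus/PlaceDatum.lean` (seat copy carried the packager Origin header of an earlier run (stripped)).
-/
/-
Origin: speedrun cell pub-hodgecm, MODEL-CONSTRUCTION sub-cell, lineage mc-binder-2 (BINDER-OWNERS rows 18/19: E binders
`hyp12` / `hyp34` of `Model.perL_picardCM_r15A`), seat prover-pub-hodgecm-mc-binder-2-g10-0 (gen 10), 2026-08-19.
Target in PKG: `HodgeCM/Model/HypCensus/PlaceDatum.lean` (NEW additive leaf; imports this lineage's `HypCensus/InsBlock` (#12) and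
`HypCensus/HypDictionary` (#13)).
KERNEL ONLY: 0 records-as-hypotheses, nothing cited, 0 `def … : Prop`; one DATA structure (`PlaceDatum`, proof-obligation fields
discharged by its four constructors), definitions,
`rfl`/`simp`-grade lemmas and one dictionary lemma.
-/
import Summits.HodgeConjecture.HodgeCM.Model.HypCensus.InsBlock
import Summits.HodgeConjecture.HodgeCM.Model.HypCensus.HypDictionary

/-!
# Census kit (rows A12/A34): the datum of a place — places, kinds, per-place embeddings, the hyperbolic dictionary

The census record `HypSideW W₀ jT kind lam hlam m₁ m₂` (`HypCensus/SideW`, #22) wants, per good sextic context, a kind map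
`kind : InfinitePlace L → PlaceKind`, Adams parameters `lam`, and the printed insertion
`ins : FinIdx → 𝓕_print →ₗ[ℂ] 𝒮(𝔸_{L⁺}^{Fin 6})`, `𝓕_print = ⨂_b 𝓕^{κ_b}_b` the tensor product over the infinite places `b` of
the CM field `L` of pv12's printed local κ-parts (`ℂ[P] ⊂ ℂ[z_a, w_a]` at `Σ₁₂`, `ℂ·1 ⊂ ℂ[M₃ₓ₂]` at `D₁₂`, `ℂ·det z ⊂ ℂ[z_{aj}, w_j]`
at `ι₁`).  This leaf FIXES that data from ONE per-place datum and proves the two bookkeeping lemmas every field proof starts from.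

* §1 `cmPlacesEquiv L : InfinitePlace L ≃ {v : InfinitePlace L⁺ // v.IsReal}` (Mathlib `IsCMField.equivInfinitePlace` + `L⁺`
  totally real); `cmPlacesEquiv_mk : cmPlacesEquiv L (mk ι₁) = cmPlace L ι₁`.
* §2 kind-indexed printed models: `KindVar k` (the variables of the model of kind `k`), `kindIncl … k : 𝓕^{κ}_k →ₗ ℂ[KindVar k]`
  (the three `Submodule.subtype`s, `rfl`-typed against `printLoc`), `kindIncl_hypLoc` (the slot operator `hypLoc` IS `printedHyp`
  at `Σ₁₂`; vacuous elsewhere).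
* §3 **`PlaceDatum … v`** (a STRUCTURE) — the DATA of a place `v` read in the CANONICAL block frame of the pin (all four
  relabellings `Equiv.refl`, index `cmIdx v : Fin 6 ≃ DPIdx P Q R S`): fields `kind`, `lam` (Adams parameter), `idx : KindVar kind → Fin 6`
  (the printed variables as coordinates of the pin), `r₀ u`/`s₀ u` (the `W`-lines of a hyperbolic direction `u : HypIdx kind` — a
  direction exists only at `Σ₁₂`), and two OBLIGATIONS: `slot_shape` (`W_v ≅ U(1,1)`, `V_v` definite) and `hyp_dict` = LEMMA A
  (Konno–Konno's `W`-side boost generator of `u` acts on the inserted printed vectors by the printed slot operator `hypLoc … u`);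
  CONSTRUCTORS discharging them: `sigmaPos eA hQ r₀ s₀ hR hS` (`V_v` read positive, `λ = −π⁻¹`, #13's dictionary — the boost
  generator reads `λ = −π⁻¹` on the `(p, r₀)|(p, s₀)` planes, tree `JunctionSwapBargmann.hypOpWGen_binvPi_frame`), `sigmaNeg` (`V_v`
  read negative, `λ = +π⁻¹` on the `(q, r₀)|(q, s₀)` planes, §4), `delta j` / `iota j` (no direction: vacuous obligations; their
  K-type / torus dictionaries are the business of the (J-x₀)/(J-T) leaves); the EMBEDDING `emb vac d : 𝓕^{κ}_{d.kind} →ₗ ℂ[z_{Fin 6}]`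
  (`rename d.idx ∘ kindIncl`) and **`hypOpWGen_binvPi_emb`** (LEMMA A in `emb` form) — so no `kind b = .sigma` rewriting is ever
  needed downstream: every per-place statement is about a VARIABLE datum `d` and is instantiated at `datum b`.
* §4 `mixedToDPIdxNeg` + `hypOpWGen_binvPi_rename_printedHyp_neg` — the `[IsEmpty P']` twin of #13's dictionary (`λ = +π⁻¹`).
* the GLOBAL data (`kindOf`, `lamOf`, `embOf`, `ins`, `ins_tprod_eq_block`, …) is the sibling leaf `HypCensus/Ins`.

Nothing here is a claim of PerL/QW8.  Style lint (L-notation): no `local notation`.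
-/

set_option autoImplicit false

noncomputable section

open scoped TensorProduct Classical
open MvPolynomial NumberField NumberField.InfinitePlace Complex
open Literature.Analysis.SegalBargmann Literature.NumberTheory.Weil1964 Literature.NumberTheory.Automorphic
open Literature.RepresentationTheory (atPlace)
open Literature.RepresentationTheory.KonnoKonno2007 Literature.RepresentationTheory.KonnoKonno2007.RealDualPair
open HodgeCM.PerL34.Fock HodgeCM.PerL34.Fock.PrintDict

namespace HodgeCM.Model.HypCensus

/-! ## §1 Infinite places of the CM field `L` ≃ real places of `L⁺` -/

section Places

variable (L : Type) [Field L] [NumberField L] [IsCMField L]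

/-- **the infinite places of the CM field `L` are the real places of `L⁺`**: restriction (Mathlib `IsCMField.equivInfinitePlace`;
`L⁺` is totally real, so every place of it is real). -/
def cmPlacesEquiv : InfinitePlace L ≃ {v : InfinitePlace ↥(maximalRealSubfield L) // v.IsReal} :=
  (IsCMField.equivInfinitePlace L).trans (Equiv.subtypeUnivEquiv fun v => IsTotallyReal.isReal v).symm

/-- (Ported verbatim from the HodgeCMPerL package; no docstring in the source.) -/
@[simp] theorem coe_cmPlacesEquiv_apply (b : InfinitePlace L) :
    ((cmPlacesEquiv L b : {v : InfinitePlace ↥(maximalRealSubfield L) // v.IsReal}) :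
      InfinitePlace ↥(maximalRealSubfield L)) = b.comap (algebraMap ↥(maximalRealSubfield L) L) := rfl

/-- the place of the distinguished embedding goes to discharge-3's `cmPlace L ι₁` (definitionally). -/
theorem cmPlacesEquiv_mk (ι₁ : L →+* ℂ) : cmPlacesEquiv L (InfinitePlace.mk ι₁) = cmPlace L ι₁ := rfl

/-- (Ported verbatim from the HodgeCMPerL package; no docstring in the source.) -/
theorem coe_cmPlacesEquiv_symm_apply (v : {v : InfinitePlace ↥(maximalRealSubfield L) // v.IsReal}) :
    ((cmPlacesEquiv L).symm v).comap (algebraMap ↥(maximalRealSubfield L) L) = v.1 := by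
  conv_rhs => rw [← (cmPlacesEquiv L).apply_symm_apply v]
  rfl

/-- the inverse is Weil's chosen place over `v` (`cmPlaceOver`, the place used by the pin's frames). -/
theorem cmPlacesEquiv_symm_apply (v : {v : InfinitePlace ↥(maximalRealSubfield L) // v.IsReal}) :
    (cmPlacesEquiv L).symm v = (cmPlaceOver L v).1 := by
  rw [cmPlaceOver_eq_mk L v ((cmPlacesEquiv L).symm v).embedding (by rw [mk_embedding]; exact coe_cmPlacesEquiv_symm_apply L v),
    mk_embedding]

end Places

/-! ## §2 Kind-indexed printed local models -/

section Kinds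

/-- the variables of pv12's printed polynomial model of each kind: `z_a, w_a` (`Σ₁₂`), `z_{aj}` (`D₁₂`), `z_{aj}, w_j` (`ι₁`). -/
@[reducible] def KindVar (k : PlaceKind) : Type :=
  @PlaceKind.rec (fun _ => Type) MixedVar EqVar PlaneVar MixedVar k

/-- (Ported verbatim from the HodgeCMPerL package; no docstring in the source.) -/
@[simp] theorem kindVar_sigma : KindVar .sigma = MixedVar := rfl
/-- (Ported verbatim from the HodgeCMPerL package; no docstring in the source.) -/
@[simp] theorem kindVar_delta : KindVar .delta = EqVar := rfl
/-- (Ported verbatim from the HodgeCMPerL package; no docstring in the source.) -/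
@[simp] theorem kindVar_iota : KindVar .iota = PlaneVar := rfl
/-- (Ported verbatim from the HodgeCMPerL package; no docstring in the source.) -/
@[simp] theorem kindVar_sigmaSwap : KindVar .sigmaSwap = MixedVar := rfl

variable (lam : ℂ) (hlam : lam ≠ 0) (vac : Circle × Circle →* Circle)

/-- **the printed local κ-part inside its polynomial model**: `ℂ[P] ⊂ ℂ[z_a, w_a]`, `ℂ·1 ⊂ ℂ[M₃ₓ₂]`, `ℂ·det z ⊂ ℂ[z_{aj}, w_j]`
(the three carriers of `printLoc` ARE these submodule subtypes, `rfl`). -/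
def kindIncl : (k : PlaceKind) → (printLoc lam hlam vac k).M →ₗ[ℂ] MvPolynomial (KindVar k) ℂ
  | .sigma => kappaPartM.subtype
  | .delta => kappaPartE.subtype
  | .iota => kappaPartI.subtype
  | .sigmaSwap => kappaPartM.subtype

/-- `kindIncl` is injective (a subtype inclusion in each kind). -/
theorem kindIncl_injective : ∀ k : PlaceKind, Function.Injective (kindIncl lam hlam vac k)
  | .sigma => Subtype.val_injective
  | .delta => Subtype.val_injective
  | .iota => Subtype.val_injective
  | .sigmaSwap => Subtype.val_injective

/-- a hyperbolic direction exists only at a `Σ₁₂` place (of either (T12) orientation). -/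
theorem HypIdx.eq_sigma_or_eq_sigmaSwap {k : PlaceKind} (u : HypIdx k) : k = .sigma ∨ k = .sigmaSwap := by
  cases k
  · exact Or.inl rfl
  · exact (nomatch u)
  · exact (nomatch u)
  · exact Or.inr rfl

/-- **the slot operator of the census read in the polynomial model**: at `Σ₁₂` it is pv06's `printedHyp λ` (the other kinds carry
no direction). -/
theorem kindIncl_hypLoc_sigma (u : HypIdx .sigma) (x : (printLoc lam hlam vac .sigma).M) :
    kindIncl lam hlam vac .sigma (hypLoc lam hlam vac .sigma u x) = printedHyp lam (kindIncl lam hlam vac .sigma x) := rfl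

/-- … and the same at a swapped `Σ₁₂` place (T12: same model, same slot operator). -/
theorem kindIncl_hypLoc_sigmaSwap (u : HypIdx .sigmaSwap) (x : (printLoc lam hlam vac .sigmaSwap).M) :
    kindIncl lam hlam vac .sigmaSwap (hypLoc lam hlam vac .sigmaSwap u x) =
      printedHyp lam (kindIncl lam hlam vac .sigmaSwap x) := rfl

/-- the pair symbol of the boost generator is symmetric in its two variables. [folklore] -/
theorem hypPairSymb_symm {σ : Type*} (k k' : σ) (F : MvPolynomial σ ℂ) : hypPairSymb k k' F = hypPairSymb k' k F := by
  unfold hypPairSymb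
  rw [mul_left_comm, pderiv_pderiv_comm]

end Kinds

/-! ## §3 The datum of a place in the canonical block frame -/

section Datum

variable (L : Type) [Field L] [NumberField L] [IsCMField L]
variable (dV : Fin 3 → L) (hdV : ∀ i, IsCMField.complexConj L (dV i) = dV i) (hdV0 : ∀ i, dV i ≠ 0)
variable (dW : Fin 2 → L) (hdW : ∀ i, IsCMField.complexConj L (dW i) = dW i) (hdW0 : ∀ i, dW i ≠ 0)
variable (ι₁ : L →+* ℂ) (v : {v : InfinitePlace ↥(maximalRealSubfield L) // v.IsReal})

/-- **the block index of the place `v` in the CANONICAL frame of the pin** (`cmPlaceIdxAt` with all four relabellings `refl`). -/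
abbrev cmIdx : Fin 6 ≃ DPIdx (PosIdx (cmXV L dV hdV ι₁ v)) (NegIdx (cmXV L dV hdV ι₁ v))
    (PosIdx (cmXW L dV dW hdW ι₁ v)) (NegIdx (cmXW L dV dW hdW ι₁ v)) :=
  cmPlaceIdxAt L finProdFinEquiv dV hdV dW hdW ι₁ v (Equiv.refl _) (Equiv.refl _) (Equiv.refl _) (Equiv.refl _)

/-- **The datum of an infinite place read in the canonical block frame** (`P Q` = the `V`-blocks, `R S` = the `W`-blocks of
`cmXV`/`cmXW` at `v`): the kind of the place, its Adams parameter, the identification `idx` of the printed variables with the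
coordinates `Fin 6` of the pin, the `W`-lines `r₀ u ∈ R`, `s₀ u ∈ S` of each hyperbolic direction `u` (a direction exists only at a
`Σ₁₂` place), and two OBLIGATIONS discharged by the constructors `sigmaPos` / `sigmaNeg` / `delta` / `iota` below: the slot shape
(`W_v` of signature `(1,1)`, `V_v` definite) and LEMMA A — Konno–Konno's `W`-side boost generator of the direction acts on the
inserted printed vectors by the printed slot operator `hypLoc … u`. -/
structure PlaceDatum : Type where
  /-- the kind `Σ₁₂ / D₁₂ / ι₁` of the place -/
  kind : PlaceKind
  /-- Adams's parameter of the printed local model -/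
  lam : ℂ
  lam_ne_zero : lam ≠ 0
  /-- the printed variables of the place as coordinates of the pin -/
  idx : KindVar kind → Fin 6
  /-- the positive `W`-line of a hyperbolic direction -/
  r₀ : HypIdx kind → PosIdx (cmXW L dV dW hdW ι₁ v)
  /-- the negative `W`-line of a hyperbolic direction -/
  s₀ : HypIdx kind → NegIdx (cmXW L dV dW hdW ι₁ v)
  /-- at a place with a direction: `W_v ≅ U(1,1)` and `V_v` definite (either orientation) -/
  slot_shape : HypIdx kind →
    Subsingleton (PosIdx (cmXW L dV dW hdW ι₁ v)) ∧ Subsingleton (NegIdx (cmXW L dV dW hdW ι₁ v)) ∧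
      ((IsEmpty (NegIdx (cmXV L dV hdV ι₁ v)) ∧ Nonempty (PosIdx (cmXV L dV hdV ι₁ v))) ∨
        (IsEmpty (PosIdx (cmXV L dV hdV ι₁ v)) ∧ Nonempty (NegIdx (cmXV L dV hdV ι₁ v))))
  /-- LEMMA A: the hyperbolic dictionary of every direction, for every vacuum character -/
  hyp_dict : ∀ (u : HypIdx kind) (vac : Circle × Circle →* Circle) (x : (printLoc lam lam_ne_zero vac kind).M),
    hypOpWGen (PosIdx (cmXV L dV hdV ι₁ v)) (NegIdx (cmXV L dV hdV ι₁ v)) (r₀ u) (s₀ u)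
        (binvPi (rename (cmIdx L dV hdV dW hdW ι₁ v) (rename idx (kindIncl lam lam_ne_zero vac kind x)))) =
      binvPi (rename (cmIdx L dV hdV dW hdW ι₁ v)
        (rename idx (kindIncl lam lam_ne_zero vac kind (hypLoc lam lam_ne_zero vac kind u x))))

end Datum

/-! ## §4 The negative-orientation twin of #13's hyperbolic dictionary -/

section NegDictionary

variable {Q' R' S' : Type} [Fintype Q'] [DecidableEq Q'] [Fintype R'] [DecidableEq R'] [Fintype S'] [DecidableEq S']
variable (P' : Type) (eA : Fin 3 ≃ Q') (r₀ : R') (s₀ : S')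

/-- **the printed variables in the block index when `V_v` is read NEGATIVE**: `z_a ↦ (eA a, s₀)` (same-sign block `Q × S`),
`w_a ↦ (eA a, r₀)` (mixed block `Q × R`). -/
def mixedToDPIdxNeg : MixedVar → DPIdx P' Q' R' S'
  | Sum.inl a => Sum.inl (Sum.inr (eA a, s₀))
  | Sum.inr a => Sum.inr (Sum.inr (eA a, r₀))

omit [Fintype Q'] [DecidableEq Q'] [Fintype R'] [DecidableEq R'] [Fintype S'] [DecidableEq S'] in
/-- (Ported verbatim from the HodgeCMPerL package; no docstring in the source.) -/
@[simp] theorem mixedToDPIdxNeg_inl (a : Fin 3) : mixedToDPIdxNeg P' eA r₀ s₀ (Sum.inl a) = Sum.inl (Sum.inr (eA a, s₀)) := rfl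

omit [Fintype Q'] [DecidableEq Q'] [Fintype R'] [DecidableEq R'] [Fintype S'] [DecidableEq S'] in
/-- (Ported verbatim from the HodgeCMPerL package; no docstring in the source.) -/
@[simp] theorem mixedToDPIdxNeg_inr (a : Fin 3) : mixedToDPIdxNeg P' eA r₀ s₀ (Sum.inr a) = Sum.inr (Sum.inr (eA a, r₀)) := rfl

omit [Fintype Q'] [DecidableEq Q'] [Fintype R'] [DecidableEq R'] [Fintype S'] [DecidableEq S'] in
/-- (Ported verbatim from the HodgeCMPerL package; no docstring in the source.) -/
theorem mixedToDPIdxNeg_injective : Function.Injective (mixedToDPIdxNeg P' eA r₀ s₀) := by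
  rintro (a | a) (b | b) h
  · simp only [mixedToDPIdxNeg_inl, Sum.inl.injEq, Sum.inr.injEq, Prod.mk.injEq, EmbeddingLike.apply_eq_iff_eq, and_true] at h
    rw [h]
  · exact absurd h (by simp [mixedToDPIdxNeg])
  · exact absurd h (by simp [mixedToDPIdxNeg])
  · simp only [mixedToDPIdxNeg_inr, Sum.inr.injEq, Prod.mk.injEq, EmbeddingLike.apply_eq_iff_eq, and_true] at h
    rw [h]

omit [DecidableEq Q'] [Fintype R'] [DecidableEq R'] [Fintype S'] [DecidableEq S'] in
/-- `P = Σ_a z_a w_a` reads as `Σ_{q : Q'} X_{(q,s₀)} X_{(q,r₀)}`. -/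
theorem rename_mixedToDPIdxNeg_P :
    rename (mixedToDPIdxNeg P' eA r₀ s₀) HodgeCM.PerL34.Fock.P =
      ∑ q : Q', X (Sum.inl (Sum.inr (q, s₀)) : DPIdx P' Q' R' S') * X (Sum.inr (Sum.inr (q, r₀))) := by
  rw [HodgeCM.PerL34.Fock.P, map_sum]
  simp only [HodgeCM.PerL34.Fock.mz, HodgeCM.PerL34.Fock.mw, map_mul, rename_X, mixedToDPIdxNeg_inl, mixedToDPIdxNeg_inr]
  exact Fintype.sum_equiv eA _ _ fun a => rfl

omit [DecidableEq Q'] [Fintype R'] [DecidableEq R'] [Fintype S'] [DecidableEq S'] in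
/-- **the printed hyperbolic operator at `λ = +π⁻¹` is `i Σ_q hypPairSymb(w_q, z_q)` in the block index.** -/
theorem rename_mixedToDPIdxNeg_printedHyp (F : MixedModel) :
    rename (mixedToDPIdxNeg P' eA r₀ s₀) (printedHyp ((Real.pi : ℂ))⁻¹ F) =
      I • ∑ q : Q', hypPairSymb (Sum.inr (Sum.inr (q, r₀)) : DPIdx P' Q' R' S') (Sum.inl (Sum.inr (q, s₀)))
        (rename (mixedToDPIdxNeg P' eA r₀ s₀) F) := by
  rw [show (∑ q : Q', hypPairSymb (Sum.inr (Sum.inr (q, r₀)) : DPIdx P' Q' R' S') (Sum.inl (Sum.inr (q, s₀)))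
        (rename (mixedToDPIdxNeg P' eA r₀ s₀) F)) =
      ∑ q : Q', hypPairSymb (Sum.inl (Sum.inr (q, s₀)) : DPIdx P' Q' R' S') (Sum.inr (Sum.inr (q, r₀)))
        (rename (mixedToDPIdxNeg P' eA r₀ s₀) F) from Finset.sum_congr rfl fun q _ => hypPairSymb_symm _ _ _]
  rw [printedHyp_eq_raise_add_lower, LinearMap.add_apply, LinearMap.smul_apply, LinearMap.smul_apply,
    LinearMap.mulLeft_apply, LinearMap.coe_sum, Finset.sum_apply, map_add, map_smul, map_smul, map_mul,
    rename_mixedToDPIdxNeg_P, map_sum]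
  simp only [Module.End.mul_apply, dz_apply, hypPairSymb, Finset.smul_sum, Finset.sum_add_distrib, smul_add,
    Finset.sum_mul, ← pderiv_rename (mixedToDPIdxNeg_injective P' eA r₀ s₀), mixedToDPIdxNeg_inl, mixedToDPIdxNeg_inr,
    inv_inv, smul_smul, mul_assoc, ← Equiv.sum_comp eA]

/-- **DICTIONARY, negative orientation** (`P' = ∅`: `V_v` read negative): on printed vectors Konno–Konno's `W`-side boost generator
acts by the printed hyperbolic operator at `λ = +π⁻¹`. [Folland1989, (4.24), Prop. (4.39); Ad07 via pv12/pv06] -/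
theorem hypOpWGen_binvPi_rename_printedHyp_neg [Fintype P'] [DecidableEq P'] [IsEmpty P'] (F : MixedModel) :
    hypOpWGen P' Q' r₀ s₀ (binvPi (rename (mixedToDPIdxNeg P' eA r₀ s₀) F)) =
      binvPi (rename (mixedToDPIdxNeg P' eA r₀ s₀) (printedHyp ((Real.pi : ℂ))⁻¹ F)) := by
  rw [hypOpWGen_binvPi_frame, rename_mixedToDPIdxNeg_printedHyp]
  simp only [Finset.univ_eq_empty, Finset.sum_empty, sub_zero]

end NegDictionary

/-! ## §3b Projections of the datum and LEMMA A -/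

namespace PlaceDatum

variable {L : Type} [Field L] [NumberField L] [IsCMField L]
variable {dV : Fin 3 → L} {hdV : ∀ i, IsCMField.complexConj L (dV i) = dV i}
variable {dW : Fin 2 → L} {hdW : ∀ i, IsCMField.complexConj L (dW i) = dW i}
variable {ι₁ : L →+* ℂ} {v : {v : InfinitePlace ↥(maximalRealSubfield L) // v.IsReal}}

/-- (Ported verbatim from the HodgeCMPerL package; no docstring in the source.) -/
theorem neg_inv_pi_ne_zero : -((Real.pi : ℂ))⁻¹ ≠ 0 := neg_ne_zero.2 (inv_ne_zero (ofReal_ne_zero.2 Real.pi_ne_zero))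

/-- (Ported verbatim from the HodgeCMPerL package; no docstring in the source.) -/
theorem inv_pi_ne_zero : ((Real.pi : ℂ))⁻¹ ≠ 0 := inv_ne_zero (ofReal_ne_zero.2 Real.pi_ne_zero)

/-- **a `Σ₁₂` place with `V_v` read POSITIVE** (`eA : Fin 3 ≃ P`, `Q = ∅`, `W`-lines `r₀ ∈ R`, `s₀ ∈ S`, both singletons): Adams
parameter `−π⁻¹`, variables `z_a ↦ (eA a, r₀)`, `w_a ↦ (eA a, s₀)`; LEMMA A = #13 `hypOpWGen_binvPi_rename_printedHyp`. -/
def sigmaPos (eA : Fin 3 ≃ PosIdx (cmXV L dV hdV ι₁ v)) (hQ : IsEmpty (NegIdx (cmXV L dV hdV ι₁ v)))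
    (r₀ : PosIdx (cmXW L dV dW hdW ι₁ v)) (s₀ : NegIdx (cmXW L dV dW hdW ι₁ v))
    (hR : Subsingleton (PosIdx (cmXW L dV dW hdW ι₁ v))) (hS : Subsingleton (NegIdx (cmXW L dV dW hdW ι₁ v))) :
    PlaceDatum L dV hdV dW hdW ι₁ v where
  kind := .sigma
  lam := -((Real.pi : ℂ))⁻¹
  lam_ne_zero := neg_inv_pi_ne_zero
  idx := fun x => (cmIdx L dV hdV dW hdW ι₁ v).symm (mixedToDPIdx (NegIdx (cmXV L dV hdV ι₁ v)) eA r₀ s₀ x)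
  r₀ := fun _ => r₀
  s₀ := fun _ => s₀
  slot_shape := fun _ => ⟨hR, hS, Or.inl ⟨hQ, ⟨eA 0⟩⟩⟩
  hyp_dict := fun u vac x => by
    haveI := hQ
    rw [kindIncl_hypLoc_sigma, rename_rename, rename_rename]
    have hc : (⇑(cmIdx L dV hdV dW hdW ι₁ v) ∘ fun y =>
        (cmIdx L dV hdV dW hdW ι₁ v).symm (mixedToDPIdx (NegIdx (cmXV L dV hdV ι₁ v)) eA r₀ s₀ y)) =
        mixedToDPIdx (NegIdx (cmXV L dV hdV ι₁ v)) eA r₀ s₀ :=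
      funext fun y => (cmIdx L dV hdV dW hdW ι₁ v).apply_symm_apply _
    rw [hc]
    exact hypOpWGen_binvPi_rename_printedHyp _ eA r₀ s₀ _

/-- **a `Σ₁₂` place with `V_v` read NEGATIVE** (`eA : Fin 3 ≃ Q`, `P = ∅`): Adams parameter `+π⁻¹`, variables
`z_a ↦ (eA a, s₀)`, `w_a ↦ (eA a, r₀)`; LEMMA A = §4 `hypOpWGen_binvPi_rename_printedHyp_neg`. -/
def sigmaNeg (eA : Fin 3 ≃ NegIdx (cmXV L dV hdV ι₁ v)) (hP : IsEmpty (PosIdx (cmXV L dV hdV ι₁ v)))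
    (r₀ : PosIdx (cmXW L dV dW hdW ι₁ v)) (s₀ : NegIdx (cmXW L dV dW hdW ι₁ v))
    (hR : Subsingleton (PosIdx (cmXW L dV dW hdW ι₁ v))) (hS : Subsingleton (NegIdx (cmXW L dV dW hdW ι₁ v))) :
    PlaceDatum L dV hdV dW hdW ι₁ v where
  kind := .sigma
  lam := ((Real.pi : ℂ))⁻¹
  lam_ne_zero := inv_pi_ne_zero
  idx := fun x => (cmIdx L dV hdV dW hdW ι₁ v).symm (mixedToDPIdxNeg (PosIdx (cmXV L dV hdV ι₁ v)) eA r₀ s₀ x)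
  r₀ := fun _ => r₀
  s₀ := fun _ => s₀
  slot_shape := fun _ => ⟨hR, hS, Or.inr ⟨hP, ⟨eA 0⟩⟩⟩
  hyp_dict := fun u vac x => by
    haveI := hP
    rw [kindIncl_hypLoc_sigma, rename_rename, rename_rename]
    have hc : (⇑(cmIdx L dV hdV dW hdW ι₁ v) ∘ fun y =>
        (cmIdx L dV hdV dW hdW ι₁ v).symm (mixedToDPIdxNeg (PosIdx (cmXV L dV hdV ι₁ v)) eA r₀ s₀ y)) =
        mixedToDPIdxNeg (PosIdx (cmXV L dV hdV ι₁ v)) eA r₀ s₀ :=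
      funext fun y => (cmIdx L dV hdV dW hdW ι₁ v).apply_symm_apply _
    rw [hc]
    exact hypOpWGen_binvPi_rename_printedHyp_neg _ eA r₀ s₀ _

/-- **a `Σ₁₂` place with `V_v` read POSITIVE and the SWAPPED printed orientation** (T12, RULING S5 (B1): used by the census
when `ε_v = −1`, i.e. when the positive `W`-line `r₀` is `W₂`): the data of `sigmaPos` verbatim, kind `sigmaSwap`. -/
def sigmaPosSwap (eA : Fin 3 ≃ PosIdx (cmXV L dV hdV ι₁ v)) (hQ : IsEmpty (NegIdx (cmXV L dV hdV ι₁ v)))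
    (r₀ : PosIdx (cmXW L dV dW hdW ι₁ v)) (s₀ : NegIdx (cmXW L dV dW hdW ι₁ v))
    (hR : Subsingleton (PosIdx (cmXW L dV dW hdW ι₁ v))) (hS : Subsingleton (NegIdx (cmXW L dV dW hdW ι₁ v))) :
    PlaceDatum L dV hdV dW hdW ι₁ v where
  kind := .sigmaSwap
  lam := -((Real.pi : ℂ))⁻¹
  lam_ne_zero := neg_inv_pi_ne_zero
  idx := fun x => (cmIdx L dV hdV dW hdW ι₁ v).symm (mixedToDPIdx (NegIdx (cmXV L dV hdV ι₁ v)) eA r₀ s₀ x)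
  r₀ := fun _ => r₀
  s₀ := fun _ => s₀
  slot_shape := fun _ => ⟨hR, hS, Or.inl ⟨hQ, ⟨eA 0⟩⟩⟩
  hyp_dict := fun u vac x => by
    haveI := hQ
    rw [kindIncl_hypLoc_sigmaSwap, rename_rename, rename_rename]
    have hc : (⇑(cmIdx L dV hdV dW hdW ι₁ v) ∘ fun y =>
        (cmIdx L dV hdV dW hdW ι₁ v).symm (mixedToDPIdx (NegIdx (cmXV L dV hdV ι₁ v)) eA r₀ s₀ y)) =
        mixedToDPIdx (NegIdx (cmXV L dV hdV ι₁ v)) eA r₀ s₀ :=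
      funext fun y => (cmIdx L dV hdV dW hdW ι₁ v).apply_symm_apply _
    rw [hc]
    exact hypOpWGen_binvPi_rename_printedHyp _ eA r₀ s₀ _

/-- **a `Σ₁₂` place with `V_v` read NEGATIVE and the SWAPPED printed orientation** (T12: used when `ε_v = −1`, i.e. when
the negative `W`-line `s₀` is `W₂`): the data of `sigmaNeg` verbatim, kind `sigmaSwap`. -/
def sigmaNegSwap (eA : Fin 3 ≃ NegIdx (cmXV L dV hdV ι₁ v)) (hP : IsEmpty (PosIdx (cmXV L dV hdV ι₁ v)))
    (r₀ : PosIdx (cmXW L dV dW hdW ι₁ v)) (s₀ : NegIdx (cmXW L dV dW hdW ι₁ v))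
    (hR : Subsingleton (PosIdx (cmXW L dV dW hdW ι₁ v))) (hS : Subsingleton (NegIdx (cmXW L dV dW hdW ι₁ v))) :
    PlaceDatum L dV hdV dW hdW ι₁ v where
  kind := .sigmaSwap
  lam := ((Real.pi : ℂ))⁻¹
  lam_ne_zero := inv_pi_ne_zero
  idx := fun x => (cmIdx L dV hdV dW hdW ι₁ v).symm (mixedToDPIdxNeg (PosIdx (cmXV L dV hdV ι₁ v)) eA r₀ s₀ x)
  r₀ := fun _ => r₀
  s₀ := fun _ => s₀
  slot_shape := fun _ => ⟨hR, hS, Or.inr ⟨hP, ⟨eA 0⟩⟩⟩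
  hyp_dict := fun u vac x => by
    haveI := hP
    rw [kindIncl_hypLoc_sigmaSwap, rename_rename, rename_rename]
    have hc : (⇑(cmIdx L dV hdV dW hdW ι₁ v) ∘ fun y =>
        (cmIdx L dV hdV dW hdW ι₁ v).symm (mixedToDPIdxNeg (PosIdx (cmXV L dV hdV ι₁ v)) eA r₀ s₀ y)) =
        mixedToDPIdxNeg (PosIdx (cmXV L dV hdV ι₁ v)) eA r₀ s₀ :=
      funext fun y => (cmIdx L dV hdV dW hdW ι₁ v).apply_symm_apply _
    rw [hc]
    exact hypOpWGen_binvPi_rename_printedHyp_neg _ eA r₀ s₀ _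

/-- **a place of kind `D₁₂`** with its variable identification (no direction; the obligations are vacuous). -/
def delta (j : EqVar → Fin 6) : PlaceDatum L dV hdV dW hdW ι₁ v where
  kind := .delta
  lam := -((Real.pi : ℂ))⁻¹
  lam_ne_zero := neg_inv_pi_ne_zero
  idx := j
  r₀ := fun u => nomatch u
  s₀ := fun u => nomatch u
  slot_shape := fun u => nomatch u
  hyp_dict := fun u => nomatch u


-- port_pkg: scope closed for this part
end PlaceDatum
end HodgeCM.Model.HypCensus
end
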